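import Mathlib
import Literature.NumberTheory.Irrationality.DirichletLValues.ChowlaMilnorChowlaNumberProofs
import HarnessLib

/-!
# Level raising for the Chowla–Milnor spaces: `V_k^{±}(q') ⊂ V_k^{±}(q)` for `q' ∣ q` (Lai–Li 2025, Lemma 4.1 and
# Corollary 4.2 (1)–(2)), generic in the sign

Topic `Literature/NumberTheory/Irrationality/DirichletLValues`. Proofs-only leaf (theorems only, no definition, no
named fact, no `sorry`; cell pub-zeta5, P1 g54), using the multiplication formula
`sum_range_hurwitzValue_progression` of `ChowlaMilnorChowlaNumberProofs.lean`. The identification with the typed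
`oddChowlaMilnorSpace` / the written-out `V_k(q)`, `V_k^+(q)` (half-systems) is made in the sequel
`ChowlaMilnorLevelRaisingSpacesProofs.lean`; here everything is stated for the FULL-RANGE spans
`F_s(q) = Span_ℚ {ζ(k, a/q) + s·ζ(k, 1 − a/q) : 1 ≤ a < q, (a,q) = 1}` with an arbitrary real sign parameter `s`
(`s = ∓(−1)^k` give `V_k^∓(q)` in Lai–Li's full-range description, p. 6: «`V_k^−(q) = Span_ℚ {ζ⁻(k,a/q) | 1 ≤ a < q,
(a,q) = 1}`», including their convention for `q = 2`; `s = 0` gives `V_k(q)` itself).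

## Source (read on the page)

L. Lai, J. Li, *A partial result towards the Chowla–Milnor conjecture*, arXiv:2505.12687v2 [LaiLi2025], §4 (pp. 6–7):
«**Lemma 4.1.** Let `k ≥ 2` and `q′ ≥ 2` be integers. Let `q = pq′`, where `p` is a prime number. Then, we have
`V_k⁻(q′) ⊂ V_k⁻(q)` and `V_k⁺(q′) ⊂ V_k⁺(q)`.» Proof: the distribution formulae
`p^k ζ(k, a/q′) = Σ_{j=0}^{p−1} ζ(k, (a + jq′)/q)`, `p^k ζ(k, 1 − a/q′) = Σ_{j=0}^{p−1} ζ(k, 1 − (a + jq′)/q)`; Case 1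
(`p ∣ q′`): every `(a + jq′, q) = 1`; Case 2 (`p ∤ q′`): a unique `j₀` has `p ∣ a + j₀q′`, giving
`ζ^±(k, a₁/q′) ≡ p^k ζ^±(k, a/q′) mod V_k^±(q)` with `a₁ ≡ p^{−1}a (mod q′)`, iterated along `a_n ≡ p^{−n} a` until
`a_{φ(q′)} = a`. «**Corollary 4.2.** (1) For any divisor `q′ ≥ 2` of `q`, `V⁻_k(q′) ⊂ V⁻_k(q)`, `V⁺_k(q′) ⊂ V⁺_k(q)`,
`V_k(q′) ⊂ V_k(q)`. (2) For any integer `a ∈ {1,…,q−1}` (not necessarily coprime to `q`), `ζ⁻(k,a/q) ∈ V_k⁻(q)`,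
`ζ⁺(k,a/q) ∈ V_k⁺(q)`, `ζ(k,a/q) ∈ V_k(q)`.»

## What is proved (for every real `s`; `k ≥ 2`)

* `pow_mul_hurwitzSign_eq_sum` — the distribution formula for `ζ(k,x) + sζ(k,1−x)` at `x = a/q′`, level `q′p`;
* **`span_hurwitzSign_le_of_prime`** — LEMMA 4.1: `F_s(q′) ≤ F_s(q′p)` (`p` prime, `q′ ≥ 2`), Case 2 by telescoping along
  the permutation `u ↦ u·p⁻¹` of `(ℤ/q′)^×` up to its order;
* **`span_hurwitzSign_le_of_dvd`** — COROLLARY 4.2 (1): `F_s(q′) ≤ F_s(q)` for `2 ≤ q′ ∣ q`;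
* **`hurwitzSign_mem_span_of_lt`** — COROLLARY 4.2 (2): `ζ(k,a/q) + sζ(k,1−a/q) ∈ F_s(q)` for every `1 ≤ a < q`.

HONEST FRAMING: printed unconditional lemmas made kernel theorems; Lai–Li's Theorem 1.5 (the named fact
`laiLi2025_theorem15`) is NOT discharged; nothing here concerns `ζ(5)`.
-/

noncomputable section

open Finset

open scoped Nat

namespace Literature.NumberTheory.Irrationality.DirichletLValues

open Literature.NumberTheory.Transcendental

/-! ### The distribution formula with a sign -/

/-- **Distribution formula** (Lai–Li §4): for `q′, p ≥ 1`, `1 ≤ a < q′` and any real `s`,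
`p^k (ζ(k, a/q′) + s ζ(k, 1 − a/q′)) = Σ_{j<p} (ζ(k, (a+jq′)/(q′p)) + s ζ(k, 1 − (a+jq′)/(q′p)))`
(`a + q′ℕ = ⊔_j (a + jq′ + qℕ)`, `q′ − a + q′ℕ = ⊔_j (q′ − a + jq′ + qℕ)`).
[cite: LaiLi2025, proof of Lemma 4.1 (p. 7, the two distribution formulae)] -/
theorem pow_mul_hurwitzSign_eq_sum {k q' p a : ℕ} (hk : 2 ≤ k) (hq' : 1 ≤ q') (hp : 1 ≤ p) (ha1 : 1 ≤ a)
    (haq : a < q') (s : ℝ) :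
    (p : ℝ) ^ k * (hurwitzValue k ((a : ℝ) / q') + s * hurwitzValue k (1 - (a : ℝ) / q')) =
      ∑ j ∈ range p, (hurwitzValue k (((a + j * q' : ℕ) : ℝ) / ((q' * p : ℕ) : ℝ)) +
        s * hurwitzValue k (1 - ((a + j * q' : ℕ) : ℝ) / ((q' * p : ℕ) : ℝ))) := by
  have h1 := sum_range_hurwitzValue_progression (u := a) (v := q') (d := p) (s := k) ha1 hq' hp hk
  have h2 := sum_range_hurwitzValue_progression (u := q' - a) (v := q') (d := p) (s := k) (by omega) hq' hp hk
  have hq0 : (q' : ℝ) ≠ 0 := by exact_mod_cast (show q' ≠ 0 by omega)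
  have hp0 : (p : ℝ) ≠ 0 := by exact_mod_cast (show p ≠ 0 by omega)
  -- `1 − (a + jq′)/(q′p) = ((q′ − a) + (p − 1 − j)q′)/(q′p)`: reflect the second sum
  have hrefl : ∑ j ∈ range p, hurwitzValue k (1 - ((a + j * q' : ℕ) : ℝ) / ((q' * p : ℕ) : ℝ)) =
      ∑ j ∈ range p, hurwitzValue k (((q' - a + j * q' : ℕ) : ℝ) / ((q' * p : ℕ) : ℝ)) := by
    rw [← Finset.sum_range_reflect (fun j => hurwitzValue k (((q' - a + j * q' : ℕ) : ℝ) / ((q' * p : ℕ) : ℝ))) p]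
    refine Finset.sum_congr rfl fun j hj => ?_
    have hjp : j < p := Finset.mem_range.1 hj
    congr 1
    simp only [Nat.cast_add, Nat.cast_mul, Nat.cast_sub haq.le, Nat.cast_sub (show j ≤ p - 1 by omega),
      Nat.cast_sub hp, Nat.cast_one]
    field_simp
    ring
  have e2 : hurwitzValue k (1 - (a : ℝ) / q') = hurwitzValue k (((q' - a : ℕ) : ℝ) / q') := by
    rw [Nat.cast_sub haq.le]; congr 1; field_simp
  rw [Finset.sum_add_distrib, ← Finset.mul_sum, hrefl, h1, h2, e2]
  ring

/-! ### Lemma 4.1: one prime at a time -/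

/-- A generator of the full-range span. [folklore] -/
private theorem hurwitzSign_mem_span {k q a : ℕ} (s : ℝ) (ha1 : 1 ≤ a) (haq : a < q) (hcop : Nat.Coprime a q) :
    hurwitzValue k ((a : ℝ) / q) + s * hurwitzValue k (1 - (a : ℝ) / q) ∈
      Submodule.span ℚ {y : ℝ | ∃ a : ℕ, 1 ≤ a ∧ a < q ∧ Nat.Coprime a q ∧
        y = hurwitzValue k ((a : ℝ) / q) + s * hurwitzValue k (1 - (a : ℝ) / q)} :=
  Submodule.subset_span ⟨a, ha1, haq, hcop, rfl⟩

/-- If `c·x ∈ W` for a non-zero rational `c` (acting through `ℝ`) then `x ∈ W`. [folklore] -/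
private theorem mem_of_ratCast_mul_mem {W : Submodule ℚ ℝ} {c : ℚ} (hc : c ≠ 0) {x : ℝ} (h : (c : ℝ) * x ∈ W) :
    x ∈ W := by
  have : x = c⁻¹ • ((c : ℝ) * x) := by
    rw [Rat.smul_def]; push_cast; field_simp
  rw [this]
  exact Submodule.smul_mem _ _ h

/-- **Lai–Li 2025, Lemma 4.1** (generic sign; `F_s(q) = Span_ℚ {ζ(k,a/q) + sζ(k,1−a/q) : 1 ≤ a < q, (a,q) = 1}`): for a
prime `p`, `q′ ≥ 2` and `k ≥ 2`, `F_s(q′) ≤ F_s(q′p)` — Case 1 (`p ∣ q′`): all summands of the distribution formula are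
generators; Case 2 (`p ∤ q′`): `p^k ζ_s(k, a/q′) − ζ_s(k, a₁/q′) ∈ F_s(q′p)` with `a₁ ≡ p^{−1}a (mod q′)`, telescoped along
the orbit of `u ↦ up^{−1}` in `(ℤ/q′)^×` («Continuing in this way … `a_n ≡ p^{−n} a (mod q′)`»).
[cite: LaiLi2025, Lemma 4.1 and its proof (pp. 6–7)] -/
theorem span_hurwitzSign_le_of_prime {k q' p : ℕ} (hk : 2 ≤ k) (hq' : 2 ≤ q') (hp : p.Prime) (s : ℝ) :
    Submodule.span ℚ {y : ℝ | ∃ a : ℕ, 1 ≤ a ∧ a < q' ∧ Nat.Coprime a q' ∧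
        y = hurwitzValue k ((a : ℝ) / q') + s * hurwitzValue k (1 - (a : ℝ) / q')} ≤
      Submodule.span ℚ {y : ℝ | ∃ a : ℕ, 1 ≤ a ∧ a < q' * p ∧ Nat.Coprime a (q' * p) ∧
        y = hurwitzValue k ((a : ℝ) / ((q' * p : ℕ) : ℝ)) + s * hurwitzValue k (1 - (a : ℝ) / ((q' * p : ℕ) : ℝ))} := by
  set T := Submodule.span ℚ {y : ℝ | ∃ a : ℕ, 1 ≤ a ∧ a < q' * p ∧ Nat.Coprime a (q' * p) ∧
      y = hurwitzValue k ((a : ℝ) / ((q' * p : ℕ) : ℝ)) + s * hurwitzValue k (1 - (a : ℝ) / ((q' * p : ℕ) : ℝ))}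
    with hT
  have hp1 : 1 ≤ p := hp.one_lt.le
  have hpk : ((p : ℚ) ^ k) ≠ 0 := pow_ne_zero _ (by exact_mod_cast hp.ne_zero)
  -- the summands `y_j = ζ_s(k, (a + jq′)/(q′p))` and when they are generators
  have hgen : ∀ {a j : ℕ}, 1 ≤ a → a < q' → Nat.Coprime a q' → j < p → ¬ p ∣ a + j * q' →
      hurwitzValue k (((a + j * q' : ℕ) : ℝ) / ((q' * p : ℕ) : ℝ)) +
        s * hurwitzValue k (1 - ((a + j * q' : ℕ) : ℝ) / ((q' * p : ℕ) : ℝ)) ∈ T := by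
    intro a j ha1 haq hcop hjp hndvd
    refine hurwitzSign_mem_span s (by omega) ?_ ?_
    · calc a + j * q' < q' + j * q' := by omega
        _ = (j + 1) * q' := by ring
        _ ≤ p * q' := Nat.mul_le_mul_right _ (by omega)
        _ = q' * p := mul_comm _ _
    · refine Nat.Coprime.mul_right ((Nat.coprime_add_mul_right_left a q' j).2 hcop) ?_
      exact ((Nat.Prime.coprime_iff_not_dvd hp).2 hndvd).symm
  refine Submodule.span_le.2 ?_
  rintro x ⟨a, ha1, haq, hcop, rfl⟩
  by_cases hdvd : p ∣ q'
  · -- Case 1: `p ∣ q′`, every `a + jq′` is coprime to `q′p`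
    have hsum := pow_mul_hurwitzSign_eq_sum (p := p) hk (by omega) hp1 ha1 haq s
    have hmem : (p : ℝ) ^ k * (hurwitzValue k ((a : ℝ) / q') + s * hurwitzValue k (1 - (a : ℝ) / q')) ∈ T := by
      rw [hsum]
      refine Submodule.sum_mem _ fun j hj => hgen ha1 haq hcop (Finset.mem_range.1 hj) fun h => ?_
      have hpa : p ∣ a := by
        exact (Nat.dvd_add_left (Dvd.dvd.mul_left hdvd j)).1 h
      exact absurd (Nat.Coprime.coprime_dvd_right hdvd hcop) (by
        rw [Nat.coprime_comm, Nat.Prime.coprime_iff_not_dvd hp]; exact fun hn => hn hpa)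
    refine mem_of_ratCast_mul_mem hpk ?_
    push_cast
    exact hmem
  · -- Case 2: `p ∤ q′`: telescoping along `u ↦ u p⁻¹` in `(ℤ/q′)^×`
    haveI : NeZero q' := ⟨by omega⟩
    haveI : Fact (1 < q') := ⟨by omega⟩
    haveI : Fact p.Prime := ⟨hp⟩
    have hcopp : Nat.Coprime p q' := (Nat.Prime.coprime_iff_not_dvd hp).2 hdvd
    set ρ : (ZMod q')ˣ := ZMod.unitOfCoprime p hcopp with hρ
    -- the quantity attached to a unit `u`: `X(u) = ζ_s(k, val(u)/q′)`
    -- one step: `p^k X(u) − X(u ρ⁻¹) ∈ T`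
    have hstep : ∀ u : (ZMod q')ˣ,
        (p : ℝ) ^ k * (hurwitzValue k ((((u : ZMod q').val : ℕ) : ℝ) / q') +
            s * hurwitzValue k (1 - (((u : ZMod q').val : ℕ) : ℝ) / q')) -
          (hurwitzValue k (((((u * ρ⁻¹ : (ZMod q')ˣ) : ZMod q').val : ℕ) : ℝ) / q') +
            s * hurwitzValue k (1 - ((((u * ρ⁻¹ : (ZMod q')ˣ) : ZMod q').val : ℕ) : ℝ) / q')) ∈ T := by
      intro u
      set b := (u : ZMod q').val with hb
      have hb1 : 1 ≤ b := by
        rw [Nat.one_le_iff_ne_zero, hb]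
        exact fun h => u.ne_zero ((ZMod.val_eq_zero _).1 h)
      have hbq : b < q' := ZMod.val_lt _
      have hbcop : Nat.Coprime b q' := ZMod.val_coe_unit_coprime u
      -- the index `j₀` with `p ∣ b + j₀ q′`
      have hq'p : (q' : ZMod p) ≠ 0 := by
        rw [Ne, ZMod.natCast_eq_zero_iff]; exact hdvd
      set j₀ : ℕ := ((-(b : ZMod p)) * (q' : ZMod p)⁻¹).val with hj₀
      have hj₀p : j₀ < p := ZMod.val_lt _
      have hj₀div : p ∣ b + j₀ * q' := by
        rw [← ZMod.natCast_eq_zero_iff]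
        push_cast
        rw [hj₀, ZMod.natCast_zmod_val, mul_assoc, inv_mul_cancel₀ hq'p, mul_one, add_neg_cancel]
      have huniq : ∀ j : ℕ, j < p → p ∣ b + j * q' → j = j₀ := by
        intro j hjp hj
        rw [← ZMod.natCast_eq_zero_iff] at hj
        push_cast at hj
        have hj' : (j : ZMod p) = (-(b : ZMod p)) * (q' : ZMod p)⁻¹ := by
          rw [eq_mul_inv_iff_mul_eq₀ hq'p]
          linear_combination hj
        have e : (j : ZMod p) = (j₀ : ZMod p) := by rw [hj', hj₀, ZMod.natCast_zmod_val]
        rw [ZMod.natCast_eq_natCast_iff'] at e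
        rwa [Nat.mod_eq_of_lt hjp, Nat.mod_eq_of_lt hj₀p] at e
      -- `a₁ = (b + j₀q′)/p`
      obtain ⟨a₁, ha₁⟩ := hj₀div
      have ha₁1 : 1 ≤ a₁ := by
        rcases Nat.eq_zero_or_pos a₁ with h | h
        · rw [h, mul_zero] at ha₁; omega
        · exact h
      have ha₁q : a₁ < q' := by
        have h1 : b + j₀ * q' < p * q' := by
          calc b + j₀ * q' < q' + j₀ * q' := by omega
            _ = (j₀ + 1) * q' := by ring
            _ ≤ p * q' := Nat.mul_le_mul_right _ (by omega)
        rw [ha₁] at h1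
        exact Nat.lt_of_mul_lt_mul_left h1
      -- `val (u ρ⁻¹) = a₁`
      have hval : ((u * ρ⁻¹ : (ZMod q')ˣ) : ZMod q').val = a₁ := by
        have e1 : ((p : ZMod q')) * (a₁ : ZMod q') = (u : ZMod q') := by
          have := congrArg (fun n : ℕ => (n : ZMod q')) ha₁
          simp only [Nat.cast_add, Nat.cast_mul, ZMod.natCast_self, mul_zero, add_zero] at this
          rw [← this, hb, ZMod.natCast_zmod_val]
        have e2 : ((u * ρ⁻¹ : (ZMod q')ˣ) : ZMod q') = (a₁ : ZMod q') := by
          rw [Units.val_mul, ← e1, hρ]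
          rw [show ((p : ZMod q')) = ((ZMod.unitOfCoprime p hcopp : (ZMod q')ˣ) : ZMod q') from
            (ZMod.coe_unitOfCoprime p hcopp).symm]
          rw [mul_comm, Units.inv_mul_cancel_left]
        rw [e2, ZMod.val_natCast, Nat.mod_eq_of_lt ha₁q]
      rw [hval]
      -- the distribution formula, split at `j₀`
      have hsum := pow_mul_hurwitzSign_eq_sum (p := p) hk (by omega) hp1 hb1 hbq s
      rw [← Finset.add_sum_erase _ _ (Finset.mem_range.2 hj₀p)] at hsum
      have ej₀ : ((b + j₀ * q' : ℕ) : ℝ) / ((q' * p : ℕ) : ℝ) = (a₁ : ℝ) / q' := by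
        rw [ha₁]
        have hp0 : (p : ℝ) ≠ 0 := by exact_mod_cast hp.ne_zero
        have hq0 : (q' : ℝ) ≠ 0 := by exact_mod_cast (show q' ≠ 0 by omega)
        push_cast
        field_simp
      rw [ej₀] at hsum
      rw [hsum, add_sub_cancel_left]
      refine Submodule.sum_mem _ fun j hj => ?_
      obtain ⟨hjne, hjr⟩ := Finset.mem_erase.1 hj
      exact hgen hb1 hbq hbcop (Finset.mem_range.1 hjr) fun h => hjne (huniq j (Finset.mem_range.1 hjr) (by
        obtain ⟨c, hc⟩ := h; exact ⟨c, hc⟩))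
    -- telescoping: `p^{nk} X(u) − X(u ρ^{-n}) ∈ T`
    have htel : ∀ (n : ℕ) (u : (ZMod q')ˣ),
        (p : ℝ) ^ (n * k) * (hurwitzValue k ((((u : ZMod q').val : ℕ) : ℝ) / q') +
            s * hurwitzValue k (1 - (((u : ZMod q').val : ℕ) : ℝ) / q')) -
          (hurwitzValue k (((((u * (ρ ^ n)⁻¹ : (ZMod q')ˣ) : ZMod q').val : ℕ) : ℝ) / q') +
            s * hurwitzValue k (1 - ((((u * (ρ ^ n)⁻¹ : (ZMod q')ˣ) : ZMod q').val : ℕ) : ℝ) / q')) ∈ T := by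
      intro n
      induction n with
      | zero => intro u; simp
      | succ n ih =>
        intro u
        have h1 := ih u
        have h2 := hstep (u * (ρ ^ n)⁻¹)
        have e : u * (ρ ^ (n + 1))⁻¹ = u * (ρ ^ n)⁻¹ * ρ⁻¹ := by
          rw [pow_succ, mul_inv_rev, ← mul_assoc, mul_assoc u, mul_comm ρ⁻¹, ← mul_assoc]
        rw [e]
        have hsm : ∀ Y : ℝ, ((p : ℚ) ^ k) • Y = (p : ℝ) ^ k * Y := fun Y => by
          rw [Rat.smul_def]; push_cast; rfl
        have h1' := Submodule.smul_mem T ((p : ℚ) ^ k) h1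
        rw [hsm] at h1'
        convert T.add_mem h1' h2 using 1
        rw [Nat.succ_mul, pow_add]
        ring
    -- at `n = orderOf ρ` the orbit closes
    set n := orderOf ρ with hn
    have hnpos : 0 < n := orderOf_pos ρ
    have hρn : (ρ ^ n)⁻¹ = 1 := by rw [hn, pow_orderOf_eq_one, inv_one]
    set u : (ZMod q')ˣ := ZMod.unitOfCoprime a hcop with hu
    have hvalu : ((u : ZMod q').val : ℕ) = a := by
      rw [hu, ZMod.coe_unitOfCoprime, ZMod.val_natCast, Nat.mod_eq_of_lt haq]
    have h := htel n u
    rw [hρn, mul_one, hvalu, ← sub_one_mul] at h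
    have hc : ((p : ℚ) ^ (n * k) - 1) ≠ 0 := by
      have : (1 : ℚ) < (p : ℚ) ^ (n * k) :=
        one_lt_pow₀ (by exact_mod_cast hp.one_lt) (Nat.mul_ne_zero hnpos.ne' (by omega))
      exact (sub_pos.mpr this).ne'
    refine mem_of_ratCast_mul_mem hc ?_
    push_cast
    exact h

/-! ### Corollary 4.2 (1): any divisor -/

/-- **Lai–Li 2025, Corollary 4.2 (1)** (generic sign): for `2 ≤ q′` dividing `q` and `k ≥ 2`, `F_s(q′) ≤ F_s(q)`
(Lemma 4.1 one prime factor of `q/q′` at a time). [cite: LaiLi2025, Corollary 4.2 (1) and its proof (p. 7)] -/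
theorem span_hurwitzSign_le_of_dvd {k q' q : ℕ} (hk : 2 ≤ k) (hq' : 2 ≤ q') (hq : q ≠ 0) (hdvd : q' ∣ q) (s : ℝ) :
    Submodule.span ℚ {y : ℝ | ∃ a : ℕ, 1 ≤ a ∧ a < q' ∧ Nat.Coprime a q' ∧
        y = hurwitzValue k ((a : ℝ) / q') + s * hurwitzValue k (1 - (a : ℝ) / q')} ≤
      Submodule.span ℚ {y : ℝ | ∃ a : ℕ, 1 ≤ a ∧ a < q ∧ Nat.Coprime a q ∧
        y = hurwitzValue k ((a : ℝ) / q) + s * hurwitzValue k (1 - (a : ℝ) / q)} := by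
  obtain ⟨m, rfl⟩ := hdvd
  have hm : m ≠ 0 := by rintro rfl; simp at hq
  -- induction over the prime factorisation of `m`, uniformly in `q′`
  suffices H : ∀ m : ℕ, m ≠ 0 → ∀ q' : ℕ, 2 ≤ q' →
      Submodule.span ℚ {y : ℝ | ∃ a : ℕ, 1 ≤ a ∧ a < q' ∧ Nat.Coprime a q' ∧
          y = hurwitzValue k ((a : ℝ) / q') + s * hurwitzValue k (1 - (a : ℝ) / q')} ≤
        Submodule.span ℚ {y : ℝ | ∃ a : ℕ, 1 ≤ a ∧ a < q' * m ∧ Nat.Coprime a (q' * m) ∧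
          y = hurwitzValue k ((a : ℝ) / ((q' * m : ℕ) : ℝ)) + s * hurwitzValue k (1 - (a : ℝ) / ((q' * m : ℕ) : ℝ))} by
    exact H m hm q' hq'
  intro m
  induction m using Nat.recOnMul with
  | zero => intro h; exact absurd rfl h
  | one => intro _ q' _; simp
  | prime p hpp => intro _ q' hq'; exact span_hurwitzSign_le_of_prime hk hq' hpp s
  | mul a b ha hb =>
    intro hab q' hq'
    have ha0 : a ≠ 0 := by rintro rfl; simp at hab
    have hb0 : b ≠ 0 := by rintro rfl; simp at hab
    have h1 := ha ha0 q' hq'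
    have h2 := hb hb0 (q' * a) (le_trans hq' (Nat.le_mul_of_pos_right _ (Nat.pos_of_ne_zero ha0)))
    rw [show q' * (a * b) = q' * a * b by ring]
    exact h1.trans (by simpa only [Nat.cast_mul] using h2)

/-! ### Corollary 4.2 (2): indices not coprime to the level -/

/-- **Lai–Li 2025, Corollary 4.2 (2)** (generic sign): for `k ≥ 2`, `q ≥ 2` and EVERY `1 ≤ a < q` (not necessarily coprime
to `q`), `ζ(k, a/q) + s ζ(k, 1 − a/q) ∈ F_s(q)`: with `g = (a,q)`, `a/q = (a/g)/(q/g)` is a generator at the level `q/g ≥ 2`,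
which divides `q`. [cite: LaiLi2025, Corollary 4.2 (2) and its proof (p. 7)] -/
theorem hurwitzSign_mem_span_of_lt {k q a : ℕ} (hk : 2 ≤ k) (ha1 : 1 ≤ a) (haq : a < q) (s : ℝ) :
    hurwitzValue k ((a : ℝ) / q) + s * hurwitzValue k (1 - (a : ℝ) / q) ∈
      Submodule.span ℚ {y : ℝ | ∃ a : ℕ, 1 ≤ a ∧ a < q ∧ Nat.Coprime a q ∧
        y = hurwitzValue k ((a : ℝ) / q) + s * hurwitzValue k (1 - (a : ℝ) / q)} := by
  set g := Nat.gcd a q with hg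
  have hg0 : 0 < g := Nat.gcd_pos_of_pos_left _ (by omega)
  obtain ⟨a', ha'⟩ : g ∣ a := Nat.gcd_dvd_left a q
  obtain ⟨q'', hq''⟩ : g ∣ q := Nat.gcd_dvd_right a q
  have ha'1 : 1 ≤ a' := by
    rcases Nat.eq_zero_or_pos a' with h | h
    · rw [h, mul_zero] at ha'; omega
    · exact h
  have ha'q : a' < q'' := by
    have : g * a' < g * q'' := by rw [← ha', ← hq'']; exact haq
    exact Nat.lt_of_mul_lt_mul_left this
  have hq''2 : 2 ≤ q'' := by omega
  have hcop : Nat.Coprime a' q'' := by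
    have h := Nat.coprime_div_gcd_div_gcd (m := a) (n := q) hg0
    rw [← hg] at h
    have e1 : a / g = a' := by rw [ha', Nat.mul_div_cancel_left _ hg0]
    have e2 : q / g = q'' := by rw [hq'', Nat.mul_div_cancel_left _ hg0]
    rwa [e1, e2] at h
  have hx : (a : ℝ) / q = (a' : ℝ) / q'' := by
    rw [ha', hq'']
    have hg0' : (g : ℝ) ≠ 0 := by exact_mod_cast hg0.ne'
    push_cast
    field_simp
  rw [hx]
  have hle := span_hurwitzSign_le_of_dvd (k := k) hk hq''2 (show q ≠ 0 by omega) ⟨g, by rw [hq'', mul_comm]⟩ s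
  exact hle (hurwitzSign_mem_span s ha'1 ha'q hcop)

end Literature.NumberTheory.Irrationality.DirichletLValues

end
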